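/-
Copyright (c) 2026 the pub-hodgecm-mathlib formalisation cell (harness21).  Prover seat hodgecm-mathlib-LH4-p16 (g2), req620 Track A «(D-RAM) FOUR-FRAME» squad
(STAGE-1b, row (2) of the piece `f_{T₊}`, the (β₂) road (R-36); β₂ sub-dealer LH4-p04 (g9) (L-Σ-3C), lane-C hinge LH7-p10 (g2); the `E`-side regime letter of the
lane-C per-vertex letters ★ p861810 ∕ `…NearCellFlippedLetter`), 2026-09-04.
-/
import Summits.HodgeConjecture.HodgeConjecture.Theorems.F0P3cDyRamLabelShellFlipCardTwo      -- ★ p862206 (LH4-p15 (g0)) §5: `v_refSkew_eq` (`|t₊| = |ϖ|^{d%2}`); brings ★ №3 `mstarOfRecord`, ★ `IsRamifiedQuadraticDatum`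
import Literature.NumberTheory.LocalFields.QuadraticOrderIntegralBasis                  -- brings ★ `WildQuadraticEisensteinFrame` (`exists_fixed_coords_of_map_ne`, `v_fixed_add_fixed_mul_eq_max`, `even_log_v_of_fixed`)
import Literature.NumberTheory.LocalFields.WildQuadraticDatumTrace                     -- ★ `even_log_v_of_fixed`, `map_varpi_ne`, `v_varpi_pow`
import HarnessLib

/-!
# Crux `H413`, line LH4 «(D-RAM) FOUR-FRAME» — STAGE-1b, row (2), the (β₂) road (R-36), lane C: «THE CLEAN `E`-LETTER OF THE DEPTH MULTIPLIER IN LANE C, ANY PARITY» —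
# the `E`-part `μ_a` of `lam − jE u₀₀ = jE μ_a + jE μ_b·α` is `−f·t₊·(ϖσϖ)^b` up to `|ϖ|^{jl + g + 1 − d}` for a `σ`-fixed unit `f`, because in lane C the norm equation
# `Θlam·lam = 1` reads `N(u₀₀ + μ_a) − 1 = −σμ_b·p·(u₀₀ + μ_a) + N(α)·q·N(μ_b)` with `Θα = jE p + jE q·α`, `|p| ≤ |ϖ|^g` (`d_Θ = 2g`): `g` digits MORE than the generic reading

Cell `hodgecm-mathlib` (D-0151), FLOOR 0, crux item H413 = `stmt-HodgeConjecture-24833`, route of record `HCCMUnconditional`; squad F0∕P3c∕LH4; lane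
`--supports stmt-HodgeConjecture-24833 --as helper` (count-neutral; pays NO tier-0 row).  THEOREMS ONLY (no `def`, no instance, no notation, no `sorry`, default heartbeats);
★-only imports; states NO law; (β₂) stays a HYPOTHESIS.  DATUM-LIGHT: §1 is `E`-algebra under the sheet datum `IsRamifiedQuadraticDatum σ ϖ d t` (ANY parity of `d`); §2 is the
`E`-part of the norm equation in the two-field letters `(E, M, jE, ρ, Θ, α)` with `α` a uniformiser of `M` generating `M` over `jE(E)` (`α² = jE T·α − jE N_α`, `Θα = jE p + jE q·α`).

WHY (★ `…NearCellFlippedLetter` HEAD∕HEAD′ and ★ p861810 HEAD take the clean `E`-letter `hμa : |μ_a + f·t₊·(ϖσϖ)^b| ≤ |ϖ|^n`, `2b + m* ≤ n`, as a BINDER; ★ p861813 ∕ ★ `…CleanRegimeDeep`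
supply it for `d` EVEN from the GENERIC reading `|N(u₀₀ + μ_E) − 1| ≤ |ϖ|^{2b+δ}` of the norm equation, precision `2b + δ − d + 1` — at lane C's flip digit `jl = 2b + s0 + m* − 1`
(★ `…NearCellFlippedLetter` `hflip`) that is `g` digits SHORT of `2b + m*` (`d = g + s0`).)  THIS FILE:
* §1 `exists_fixed_unit_sub_mul_refSkew_le_any` — ★ `…CleanRegimeDeep` §1 WITHOUT `d % 2 = 0`: `|t₀| = |ϖ|^{d%2}`, `|t₀ + σt₀| ≤ |ϖ|^{N + d − 1 + d%2}`, `1 ≤ N` ⟹ `∃ f` fixed unit,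
  `|t₀ − f·t₊| ≤ |ϖ|^{N + d%2}` (Eisenstein coordinates of `t₀∕t₊`, ★ `exists_fixed_coords_of_map_ne`); `exists_fixed_unit_hlamE_of_norm` — from `u·σu = 1`, `|u − 1| ≤ |ϖ|^{N_u}`,
  `|μ_a| = |ϖ|^{2b + d%2}` and a norm reading `|N(u + μ_a) − 1| ≤ |ϖ|^R` at ANY precision `R` (`2b + d%2 + d ≤ R ≤ min(2(2b + d%2), N_u + 2b + d%2)`): `∃ f` fixed unit with
  `|μ_a + f·t₊·(ϖσϖ)^b| ≤ |ϖ|^{R + 1 − d}` — the inherent `d − 1` Eisenstein loss and NOTHING ELSE (no trace-ideal step: `N_u` is free near `1`).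
* §2 `norm_sub_one_eq_of_theta` — THE LANE-C READING: `Θlam·lam = 1`, `lam = jE A + jE B·α`, `Θ ∘ jE = jE ∘ σ`, `Θα = jE p + jE q·α`, `α·α = jE T·α − jE N_α`, `ρ` fixing `jE(E)` with
  `ρα ≠ α` ⟹ `A·σA − 1 = −(σB·p·A) + N_α·q·(B·σB)` EXACTLY (the `jE(E)`-component of `Θlam·lam − 1 = 0`; the `α`-component is recorded too); `v_norm_sub_one_le_of_theta` — with
  `|A| ≤ 1`, `|B| ≤ |ϖ|^{jl}`, `|p| ≤ |ϖ|^g`, `|q| ≤ 1`, `|N_α| ≤ 1`, `g ≤ jl`: `|A·σA − 1| ≤ |ϖ|^{jl + g}`; `v_map_theta_coeff_le` — `|p| ≤ |ϖ|^g` itself from the `Θ`-datum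
  `|α − Θα| ≤ |jEϖ|^g` (★ `v_fixed_add_fixed_mul_eq_max` over `jE(E)`: the `jE(E)`-coordinate of `α − Θα` is `−jE p`).
* §3 HEAD `exists_fixed_unit_hlamE_ramM` — §2 into §1 at `R = jl + g`: `∃ f`, `σ f = f`, `|f| = 1`, `|μ_a + f·t₊·(ϖσϖ)^b| ≤ |ϖ|^{jl + g + 1 − d}`; at the flip digit this is
  `|ϖ|^{2b + m*}` EXACTLY the letter `hμa` of ★ `…NearCellFlippedLetter` HEAD (`2b + m* ≤ n`), and deeper `jl` feed HEAD′ ∕ ★ p861810.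
WHAT IS NOT CLAIMED: the decomposition letters themselves (`lam = jE A + jE B·α`, `Θα = jE p + jE q·α` — the frame's basis over `jE(E)`), the tokens `|B| = |ϖ|^{jl}`, `|μ_a| = |ϖ|^{2b+d%2}`
(the row of the cell), lanes A∕B (there `|p|` has no gain and ★ `…CleanRegimeBoundary` is the sharp reading), the `D`-cell.
HONEST LABEL.  Count-neutral valuation algebra; nothing printed is asserted; no census law is stated; `HC_CM` is proved only modulo the 7 printed citations (2 remaining named inputs:
hLiu418 = `stmt-HodgeConjecture-24832`, h413 = `stmt-HodgeConjecture-24833`) until rung 0 closes.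
## References
* [Serre1979] J.-P. Serre, *Local Fields*, GTM 67 (1979): Ch. I §6 Prop. 18 (Eisenstein bases), Ch. III §3 Prop. 7, §6 Prop. 12, Ch. V §3 Cor. 3 (norm classes; the last digit).
* [Jacobowitz1962] R. Jacobowitz, *Hermitian forms over local fields*, Amer. J. Math. 84 (1962): §4; [Rogawski1990] J. D. Rogawski, *Automorphic Representations of Unitary Groups in
  Three Variables*, Ann. of Math. Stud. 123 (1990): §4.9 Prop. 4.9.1 (b) p. 55; [Kottwitz1986BaseChangeUnits] R. E. Kottwitz, Compositio Math. 60 (1986): §1 pp. 240–241.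
-/

set_option autoImplicit false

noncomputable section

namespace Summit.HodgeConjecture.HodgeConjecture.Cruxes.H413.F0P3cDyRamCleanELetterRamM

open scoped Valued WithZero
open WithZero
open Literature.NumberTheory.Automorphic.UnitaryThreeFourFrame (IsRamifiedQuadraticDatum)
open Literature.NumberTheory.LocalFields (exists_fixed_coords_of_map_ne v_fixed_add_fixed_mul_eq_max)
open Literature.NumberTheory.LocalFields.WildQuadraticDatum (even_log_v_of_fixed map_varpi_ne)
open Summit.HodgeConjecture.HodgeConjecture.Cruxes.H413.F0P3cDyRamFourFramePieces
open Summit.HodgeConjecture.HodgeConjecture.Cruxes.H413.F0P3cDyRamLabelShellFlipCardTwo (v_refSkew_eq)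

/-! ## §1 `E`-side, ANY parity: the fixed unit `f` from a deep trace, and from a norm reading at precision `R` -/

section ESide

variable {K : Type} [Field K] [Valued K ℤᵐ⁰] {σ : K →+* K} {ϖ : K} {d t : ℕ}

/-- **A SCALAR OF SIZE `|t₊|` WITH DEEP TRACE IS A FIXED UNIT TIMES `t₊`**, ANY parity of `d`: `|t₀| = |ϖ|^{d%2}` (`= |t₊|`, ★ `v_refSkew_eq`), `|t₀ + σt₀| ≤ |ϖ|^{N + d − 1 + d%2}`,
`1 ≤ N` ⟹ `∃ f`, `σ f = f`, `|f| = 1`, `|t₀ − f·t₊| ≤ |ϖ|^{N + d%2}` (Eisenstein coordinates `t₀∕t₊ = x₁ + y₁ϖ`, `f := x₁`; ★ `…CleanRegimeDeep` §1 is the case `d` even).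
[cite: Serre1979, Ch. I §6 Prop. 18] [cite: Serre1979, Ch. III §3 Prop. 7] -/
theorem exists_fixed_unit_sub_mul_refSkew_le_any (hD : IsRamifiedQuadraticDatum σ ϖ d t) {N : ℕ} (hN : 1 ≤ N)
    {t₀ : K} (ht₀ : Valued.v t₀ = Valued.v ϖ ^ (d % 2)) (htr : Valued.v (t₀ + σ t₀) ≤ Valued.v ϖ ^ (N + d - 1 + d % 2)) :
    ∃ f : K, σ f = f ∧ Valued.v f = 1 ∧
      Valued.v (t₀ - f * ((ϖ - σ ϖ) * ((ϖ * σ ϖ) ^ ((d - d % 2) / 2))⁻¹)) ≤ Valued.v ϖ ^ (N + d % 2) := by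
  obtain ⟨hσσ, hvσ, hϖ, hfix, hdd, hd1, -⟩ := hD
  have hvt : Valued.v ((ϖ - σ ϖ) * ((ϖ * σ ϖ) ^ ((d - d % 2) / 2))⁻¹) = Valued.v ϖ ^ (d % 2) := v_refSkew_eq hvσ hϖ hdd
  set tp : K := (ϖ - σ ϖ) * ((ϖ * σ ϖ) ^ ((d - d % 2) / 2))⁻¹ with htp
  have hvϖ0 : Valued.v ϖ ≠ 0 := by rw [hϖ]; exact exp_ne_zero
  have hϖ1 : Valued.v ϖ ≤ 1 := by rw [hϖ, ← exp_zero, exp_le_exp]; norm_num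
  have htp0 : tp ≠ 0 := fun h0 => by rw [h0, map_zero] at hvt; exact pow_ne_zero _ hvϖ0 hvt.symm
  have hvt0 : Valued.v tp ≠ 0 := (Valuation.ne_zero_iff _).2 htp0
  have hσt : σ tp = -tp := by
    rw [htp, map_mul, map_inv₀, map_pow, map_mul, map_sub, hσσ, mul_comm (σ ϖ) ϖ]; ring
  have hϖσ : σ ϖ ≠ ϖ := map_varpi_ne hϖ hdd
  have hfix' : ∀ c : K, σ c = c → c ≠ 0 → Even (log (Valued.v c)) := fun c hc hc0 => even_log_v_of_fixed hfix c hc hc0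
  obtain ⟨x₁, y₁, hx₁, hy₁, hτ⟩ := exists_fixed_coords_of_map_ne hσσ hϖσ (t₀ / tp)
  have hvτ : Valued.v (t₀ / tp) = 1 := by rw [map_div₀, ht₀, hvt, div_self (pow_ne_zero _ hvϖ0)]
  have hdiff : t₀ / tp - σ (t₀ / tp) = y₁ * (ϖ - σ ϖ) := by
    conv_lhs => rw [hτ, map_add, map_mul, hx₁, hy₁]
    ring
  have hdiff' : t₀ / tp - σ (t₀ / tp) = (t₀ + σ t₀) / tp := by
    rw [map_div₀, hσt]; field_simp; ring
  have hvy₁ : Valued.v y₁ ≤ Valued.v ϖ ^ (N - 1) := by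
    have h1 : Valued.v (y₁ * (ϖ - σ ϖ)) * Valued.v ϖ ^ (d % 2) ≤ Valued.v ϖ ^ (N + d - 1 + d % 2) := by
      rw [← hdiff, hdiff', map_div₀, hvt, div_mul_cancel₀ _ (pow_ne_zero _ hvϖ0)]; exact htr
    rw [Valuation.map_mul, hdd, pow_add, mul_assoc, ← pow_add] at h1
    have h0 : Valued.v ϖ ^ (d + d % 2) ≠ 0 := pow_ne_zero _ hvϖ0
    have h2 : Valued.v ϖ ^ (N + d - 1) = Valued.v ϖ ^ (N - 1) * Valued.v ϖ ^ d := by rw [← pow_add]; congr 1; omega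
    rw [h2, mul_assoc, ← pow_add] at h1
    exact le_of_mul_le_mul_right h1 (zero_lt_iff.2 h0)
  have hvx₁ : Valued.v x₁ = 1 := by
    have hmax := v_fixed_add_fixed_mul_eq_max hfix' hϖ hx₁ hy₁
    rw [← hτ, hvτ] at hmax
    have hlt : Valued.v y₁ * exp (-1 : ℤ) < 1 := by
      have hy1 : Valued.v y₁ ≤ 1 := hvy₁.trans (pow_le_one₀ zero_le hϖ1)
      calc Valued.v y₁ * exp (-1 : ℤ) ≤ 1 * exp (-1 : ℤ) := by gcongr
        _ < 1 := by rw [one_mul, ← exp_zero, exp_lt_exp]; norm_num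
    rcases le_total (Valued.v x₁) (Valued.v y₁ * exp (-1 : ℤ)) with h | h
    · rw [max_eq_right h] at hmax; exact absurd hmax.symm (ne_of_lt hlt)
    · rw [max_eq_left h] at hmax; exact hmax.symm
  refine ⟨x₁, hx₁, hvx₁, ?_⟩
  have hrem : t₀ - x₁ * tp = y₁ * ϖ * tp := by
    have : t₀ = (t₀ / tp) * tp := by rw [div_mul_cancel₀ t₀ htp0]
    rw [this, hτ]; ring
  rw [hrem, Valuation.map_mul, Valuation.map_mul, hvt]
  calc Valued.v y₁ * Valued.v ϖ * Valued.v ϖ ^ (d % 2) ≤ Valued.v ϖ ^ (N - 1) * Valued.v ϖ * Valued.v ϖ ^ (d % 2) := by gcongr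
    _ = Valued.v ϖ ^ (N + d % 2) := by rw [← pow_succ, ← pow_add]; congr 1; omega

/-- **THE CLEAN `E`-LETTER FROM A NORM READING AT PRECISION `R`**, ANY parity of `d`.  Letters: `u·σu = 1`, `|u − 1| ≤ |ϖ|^{N_u}` (free near `1`), `|μ_a| = |ϖ|^{2b + d%2}` (the row),
`|N(u + μ_a) − 1| ≤ |ϖ|^R` with `2b + d%2 + d ≤ R`, `R ≤ 2·(2b + d%2)`, `R ≤ N_u + 2b + d%2`.  THEN `∃ f`, `σf = f`, `|f| = 1`, `|μ_a + f·t₊·(ϖσϖ)^b| ≤ |ϖ|^{R + 1 − d}`.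
(`|μ_a + σμ_a| ≤ max(|N(u+μ_a) − 1|, |N μ_a|, |(σu − 1)μ_a|, |σ((σu − 1)μ_a)|) ≤ |ϖ|^R`, then §1 on `t₀ = −μ_a∕(ϖσϖ)^b`.) [cite: Serre1979, Ch. III §3 Prop. 7] [cite: Serre1979, Ch. V §3 Cor. 3] -/
theorem exists_fixed_unit_hlamE_of_norm (hD : IsRamifiedQuadraticDatum σ ϖ d t) {u μa : K} {b R Nu : ℕ}
    (huu : u * σ u = 1) (hu1 : Valued.v (u - 1) ≤ Valued.v ϖ ^ Nu) (hμa : Valued.v μa = Valued.v ϖ ^ (2 * b + d % 2))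
    (hN : Valued.v ((u + μa) * σ (u + μa) - 1) ≤ Valued.v ϖ ^ R)
    (hR1 : 2 * b + d % 2 + d ≤ R) (hR2 : R ≤ 2 * (2 * b + d % 2)) (hR3 : R ≤ Nu + 2 * b + d % 2) :
    ∃ f : K, σ f = f ∧ Valued.v f = 1 ∧
      Valued.v (μa + f * ((ϖ - σ ϖ) * ((ϖ * σ ϖ) ^ ((d - d % 2) / 2))⁻¹) * (ϖ * σ ϖ) ^ b) ≤ Valued.v ϖ ^ (R + 1 - d) := by
  obtain ⟨hσσ, hvσ, hϖ, -, hdd, hd1, -⟩ := id hD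
  have hvϖ0 : Valued.v ϖ ≠ 0 := by rw [hϖ]; exact exp_ne_zero
  have hϖ0 : ϖ ≠ 0 := fun h0 => by rw [h0, map_zero] at hvϖ0; exact hvϖ0 rfl
  have hϖ1 : Valued.v ϖ ≤ 1 := by rw [hϖ, ← exp_zero, exp_le_exp]; norm_num
  have hP0 : (ϖ * σ ϖ) ^ b ≠ 0 := pow_ne_zero _ (mul_ne_zero hϖ0 ((map_ne_zero σ).2 hϖ0))
  have hvP : Valued.v ((ϖ * σ ϖ) ^ b) = Valued.v ϖ ^ (2 * b) := by
    rw [Valuation.map_pow, Valuation.map_mul, hvσ, ← pow_two, ← pow_mul, mul_comm]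
  have hσP : σ ((ϖ * σ ϖ) ^ b) = (ϖ * σ ϖ) ^ b := by rw [map_pow, map_mul, hσσ, mul_comm]
  -- (1) the trace of `μ_a` is `R`-deep: `μ_a + σμ_a = (N(u+μ_a) − 1) − N(μ_a) − (σu − 1)μ_a − σ((σu − 1)μ_a)`
  have hσu1 : Valued.v (σ u - 1) ≤ Valued.v ϖ ^ Nu := by
    rw [show σ u - 1 = σ (u - 1) by rw [map_sub, map_one], hvσ]; exact hu1
  have htr : Valued.v (μa + σ μa) ≤ Valued.v ϖ ^ R := by
    have e : μa + σ μa = ((u + μa) * σ (u + μa) - 1) - μa * σ μa - (σ u - 1) * μa - σ ((σ u - 1) * μa) := by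
      rw [map_add, map_mul, map_sub, hσσ, map_one]
      linear_combination -huu
    rw [e]
    refine (Valuation.map_sub _ _ _).trans (max_le ((Valuation.map_sub _ _ _).trans (max_le ((Valuation.map_sub _ _ _).trans (max_le hN ?_)) ?_)) ?_)
    · rw [Valuation.map_mul, hvσ, hμa, ← pow_add]
      exact pow_le_pow_right_of_le_one' hϖ1 (by omega)
    · rw [Valuation.map_mul, hμa]
      calc Valued.v (σ u - 1) * Valued.v ϖ ^ (2 * b + d % 2) ≤ Valued.v ϖ ^ Nu * Valued.v ϖ ^ (2 * b + d % 2) := by gcongr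
        _ = Valued.v ϖ ^ (Nu + (2 * b + d % 2)) := by rw [← pow_add]
        _ ≤ Valued.v ϖ ^ R := pow_le_pow_right_of_le_one' hϖ1 (by omega)
    · rw [hvσ, Valuation.map_mul, hμa]
      calc Valued.v (σ u - 1) * Valued.v ϖ ^ (2 * b + d % 2) ≤ Valued.v ϖ ^ Nu * Valued.v ϖ ^ (2 * b + d % 2) := by gcongr
        _ = Valued.v ϖ ^ (Nu + (2 * b + d % 2)) := by rw [← pow_add]
        _ ≤ Valued.v ϖ ^ R := pow_le_pow_right_of_le_one' hϖ1 (by omega)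
  -- (2) normalise: `t₀ = −μ_a∕P` has `|t₀| = |ϖ|^{d%2}` and trace `≤ |ϖ|^{R − 2b}`
  set t₀ : K := -(μa / (ϖ * σ ϖ) ^ b) with ht₀def
  have ht₀ : Valued.v t₀ = Valued.v ϖ ^ (d % 2) := by
    rw [ht₀def, Valuation.map_neg, map_div₀, hμa, hvP, pow_add, mul_div_cancel_left₀ _ (pow_ne_zero _ hvϖ0)]
  have htr₀ : Valued.v (t₀ + σ t₀) ≤ Valued.v ϖ ^ ((R + 1 - d - 2 * b - d % 2) + d - 1 + d % 2) := by
    have h1 : t₀ + σ t₀ = -((μa + σ μa) / (ϖ * σ ϖ) ^ b) := by rw [ht₀def, map_neg, map_div₀, hσP]; ring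
    rw [h1, Valuation.map_neg, map_div₀, hvP, div_le_iff₀ (zero_lt_iff.2 (pow_ne_zero _ hvϖ0)), ← pow_add]
    refine htr.trans (pow_le_pow_right_of_le_one' hϖ1 ?_)
    omega
  obtain ⟨f, hσf, hf1, hfle⟩ := exists_fixed_unit_sub_mul_refSkew_le_any hD (N := R + 1 - d - 2 * b - d % 2) (by omega) ht₀ htr₀
  refine ⟨f, hσf, hf1, ?_⟩
  have hrew : μa + f * ((ϖ - σ ϖ) * ((ϖ * σ ϖ) ^ ((d - d % 2) / 2))⁻¹) * (ϖ * σ ϖ) ^ b =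
      -((ϖ * σ ϖ) ^ b) * (t₀ - f * ((ϖ - σ ϖ) * ((ϖ * σ ϖ) ^ ((d - d % 2) / 2))⁻¹)) := by
    rw [ht₀def]; field_simp; ring
  rw [hrew, Valuation.map_mul, Valuation.map_neg, hvP]
  calc Valued.v ϖ ^ (2 * b) * _ ≤ Valued.v ϖ ^ (2 * b) * Valued.v ϖ ^ ((R + 1 - d - 2 * b - d % 2) + d % 2) := by gcongr
    _ = Valued.v ϖ ^ (R + 1 - d) := by rw [← pow_add]; congr 1; omega

end ESide

/-! ## §2 `M`-side, lane C: the `jE(E)`-component of the norm equation `Θlam·lam = 1` carries the factor `p` of `Θα = jE p + jE q·α` -/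

section MSide

variable {E M : Type} [Field E] [Valued E ℤᵐ⁰] [Field M] [Valued M ℤᵐ⁰] {ρ Θ : M →+* M} {α : M}

omit [Valued E ℤᵐ⁰] [Valued M ℤᵐ⁰] in
/-- **COORDINATES OVER `jE(E)` ARE UNIQUE**: `ρ` fixes `jE(E)` and moves `α`; then `jE X + jE Y·α = 0` forces `X = 0` and `Y = 0`. [cite: Serre1979, Ch. I §6 Prop. 18] -/
theorem eq_zero_of_map_add_map_mul_eq_zero (jE : E →+* M) (hρj : ∀ c, ρ (jE c) = jE c) (hα : ρ α ≠ α) {X Y : E}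
    (h : jE X + jE Y * α = 0) : X = 0 ∧ Y = 0 := by
  have hρ : jE X + jE Y * ρ α = 0 := by
    have := congrArg ρ h
    rwa [map_add, map_mul, hρj, hρj, map_zero] at this
  have hY : jE Y * (α - ρ α) = 0 := by linear_combination h - hρ
  have hY0 : Y = 0 := by
    rcases mul_eq_zero.1 hY with h0 | h0
    · exact (map_eq_zero jE).1 h0
    · exact absurd (sub_eq_zero.1 h0).symm hα
  refine ⟨?_, hY0⟩
  rw [hY0, map_zero, zero_mul, add_zero] at h
  exact (map_eq_zero jE).1 h

omit [Valued E ℤᵐ⁰] [Valued M ℤᵐ⁰] in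
/-- **THE LANE-C READING OF THE NORM EQUATION.**  `Θlam·lam = 1`, `lam = jE A + jE B·α`, `Θ(jE c) = jE(σ c)`, `Θα = jE p + jE q·α`, `α·α = jE T·α − jE N_α`, `ρ` fixing `jE(E)`,
`ρα ≠ α` ⟹ the `jE(E)`-component: `A·σA − 1 = −(σB·p·A) + N_α·q·(B·σB)`, and the `α`-component: `(σA + σB·p)·B + σB·q·(A + B·T) = 0`.  In lane C `|p| = |ϖ|^g` (`d_Θ = 2g`), so the norm
of the `E`-part of `lam` is read `g` digits deeper than `|μ − jE μ_E|` (the generic ★ `v_map_norm_sub_one_le`). [cite: Serre1979, Ch. III §6 Prop. 12] [cite: Jacobowitz1962, §4] -/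
theorem norm_sub_one_eq_of_theta (σ : E →+* E) (jE : E →+* M) (hΘj : ∀ c, Θ (jE c) = jE (σ c)) (hρj : ∀ c, ρ (jE c) = jE c) (hα : ρ α ≠ α)
    {p q T Nα : E} (hΘα : Θ α = jE p + jE q * α) (hα2 : α * α = jE T * α - jE Nα)
    {lam : M} {A B : E} (hlam : lam = jE A + jE B * α) (hΘlam : Θ lam * lam = 1) :
    A * σ A - 1 = -(σ B * p * A) + Nα * q * (B * σ B) ∧ (σ A + σ B * p) * B + σ B * q * (A + B * T) = 0 := by
  -- expand `Θlam·lam − 1` in the basis `1, α`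
  have hexp : Θ lam * lam - 1 = jE ((σ A + σ B * p) * A - Nα * (σ B * q * B) - 1) + jE ((σ A + σ B * p) * B + σ B * q * (A + B * T)) * α := by
    have e3 : jE (σ B * q) * α * (jE B * α) = jE (σ B * q * B) * (α * α) := by rw [map_mul jE (σ B * q) B]; ring
    rw [hlam, map_add, map_mul, hΘj, hΘj, hΘα]
    simp only [map_add, map_sub, map_mul, map_one]
    have : jE (σ B) * (jE p + jE q * α) * (jE A + jE B * α) =
        jE (σ B) * jE p * jE A + (jE (σ B) * jE p * jE B + jE (σ B) * jE q * jE A) * α + jE (σ B) * jE q * jE B * (α * α) := by ring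
    rw [add_mul, this, hα2]
    ring
  rw [hΘlam, sub_self] at hexp
  obtain ⟨hX, hY⟩ := eq_zero_of_map_add_map_mul_eq_zero jE hρj hα hexp.symm
  refine ⟨?_, hY⟩
  linear_combination hX

omit [Valued M ℤᵐ⁰] in
/-- **THE NORM OF THE `E`-PART IS `(jl + g)`-DEEP**: under `norm_sub_one_eq_of_theta`'s letters with `|A| ≤ 1`, `|B| ≤ |ϖ|^{jl}`, `|p| ≤ |ϖ|^g`, `|q| ≤ 1`, `|N_α| ≤ 1`, `g ≤ jl`:
`|A·σA − 1| ≤ |ϖ|^{jl + g}`. [cite: Serre1979, Ch. III §6 Prop. 12] [cite: Serre1979, Ch. V §3 Cor. 3] -/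
theorem v_norm_sub_one_le_of_theta (σ : E →+* E) (hvσ : ∀ a, Valued.v (σ a) = Valued.v a) {ϖ : E} (hϖ1 : Valued.v ϖ ≤ 1)
    (jE : E →+* M) (hΘj : ∀ c, Θ (jE c) = jE (σ c)) (hρj : ∀ c, ρ (jE c) = jE c) (hα : ρ α ≠ α)
    {p q T Nα : E} (hΘα : Θ α = jE p + jE q * α) (hα2 : α * α = jE T * α - jE Nα)
    {lam : M} {A B : E} (hlam : lam = jE A + jE B * α) (hΘlam : Θ lam * lam = 1)
    {jl g : ℕ} (hA : Valued.v A ≤ 1) (hB : Valued.v B ≤ Valued.v ϖ ^ jl) (hp : Valued.v p ≤ Valued.v ϖ ^ g) (hq : Valued.v q ≤ 1)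
    (hNα : Valued.v Nα ≤ 1) (hgjl : g ≤ jl) :
    Valued.v (A * σ A - 1) ≤ Valued.v ϖ ^ (jl + g) := by
  rw [(norm_sub_one_eq_of_theta σ jE hΘj hρj hα hΘα hα2 hlam hΘlam).1]
  refine (Valuation.map_add _ _ _).trans (max_le ?_ ?_)
  · rw [Valuation.map_neg, Valuation.map_mul, Valuation.map_mul, hvσ, pow_add]
    calc Valued.v B * Valued.v p * Valued.v A ≤ Valued.v ϖ ^ jl * Valued.v ϖ ^ g * 1 := by gcongr
      _ = _ := mul_one _
  · rw [Valuation.map_mul, Valuation.map_mul, Valuation.map_mul, hvσ]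
    calc Valued.v Nα * Valued.v q * (Valued.v B * Valued.v B) ≤ 1 * 1 * (Valued.v ϖ ^ jl * Valued.v ϖ ^ g) := by
          gcongr
          exact hB.trans (pow_le_pow_right_of_le_one' hϖ1 hgjl)
      _ = Valued.v ϖ ^ (jl + g) := by rw [one_mul, one_mul, pow_add]

/-- **THE `Θ`-COEFFICIENT `p` IS `g`-DEEP** from the `Θ`-datum on the uniformiser `α`: if `|jE x| = |x|²` for all `x`, every `ρ`-fixed element is in `jE(E)`, `|α| = exp(−1)`,
`Θα = jE p + jE q·α` and `|α − Θα| ≤ |jEϖ|^g`, then `|p| ≤ |ϖ|^g` (the `jE(E)`-coordinate of `α − Θα` is `−jE p`; ★ `v_fixed_add_fixed_mul_eq_max` over `jE(E)`).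
[cite: Serre1979, Ch. I §6 Prop. 18] [cite: Serre1979, Ch. II §1] -/
theorem v_theta_coeff_le (jE : E →+* M) (hjpow : ∀ x, Valued.v (jE x) = Valued.v x ^ 2) (hjfix : ∀ z, ρ z = z ↔ ∃ c, jE c = z)
    (hvα : Valued.v α = exp (-1 : ℤ)) {p q ϖ : E} {g : ℕ} (hΘα : Θ α = jE p + jE q * α)
    (hdat : Valued.v (α - Θ α) ≤ Valued.v (jE ϖ) ^ g) :
    Valued.v p ≤ Valued.v ϖ ^ g := by
  have hfix : ∀ c : M, ρ c = c → c ≠ 0 → Even (log (Valued.v c)) := fun c hc hc0 => by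
    obtain ⟨x, rfl⟩ := (hjfix c).1 hc
    have hx0 : x ≠ 0 := fun h0 => hc0 (by rw [h0, map_zero])
    refine ⟨log (Valued.v x), ?_⟩
    rw [hjpow, pow_two, log_mul ((Valuation.ne_zero_iff _).2 hx0) ((Valuation.ne_zero_iff _).2 hx0)]
  have hρp : ρ (jE (-p)) = jE (-p) := (hjfix _).2 ⟨-p, rfl⟩
  have hρq : ρ (jE (1 - q)) = jE (1 - q) := (hjfix _).2 ⟨1 - q, rfl⟩
  have hcoord : α - Θ α = jE (-p) + jE (1 - q) * α := by rw [hΘα, map_neg, map_sub, map_one]; ring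
  have hmax := v_fixed_add_fixed_mul_eq_max hfix hvα hρp hρq
  rw [← hcoord] at hmax
  have h1 : Valued.v (jE (-p)) ≤ Valued.v (jE ϖ) ^ g := le_trans (by rw [hmax]; exact le_max_left _ _) hdat
  rw [map_neg, Valuation.map_neg, hjpow, hjpow, ← pow_mul, mul_comm, pow_mul] at h1
  exact le_of_pow_le_pow_left₀ two_ne_zero zero_le h1

/-! ## §3 HEAD — the clean `E`-letter of lane C at precision `jl + g + 1 − d` -/

omit [Valued M ℤᵐ⁰] in
/-- **HEAD — «THE CLEAN `E`-LETTER OF THE DEPTH MULTIPLIER IN LANE C», ANY PARITY OF `d`.**  Sheet datum `IsRamifiedQuadraticDatum σ ϖ d t` on `E`; two-field letters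
`Θ ∘ jE = jE ∘ σ`, `ρ` fixing `jE(E)`, `ρα ≠ α`; the uniformiser `α` of `M` over `jE(E)`: `α·α = jE T·α − jE N_α` (`|N_α| ≤ 1`), `Θα = jE p + jE q·α` (`|p| ≤ |ϖ|^g`, `|q| ≤ 1` —
§2 `v_theta_coeff_le` reads `|p|` off `d_Θ = 2g`); the torus element `lam = jE(u + μ_a) + jE μ_b·α` with `Θlam·lam = 1`, `u·σu = 1`, `|u − 1| ≤ |ϖ|^{N_u}`, `|u + μ_a| ≤ 1`; the
tokens `|μ_a| = |ϖ|^{2b + d%2}` (the row) and `|μ_b| ≤ |ϖ|^{jl}`; side conditions `g ≤ jl`, `2b + d%2 + d ≤ jl + g ≤ 2(2b + d%2)`, `jl + g ≤ N_u + 2b + d%2`.  THEN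
`∃ f`, `σ f = f`, `|f| = 1`, `|μ_a + f·t₊·(ϖσϖ)^b| ≤ |ϖ|^{jl + g + 1 − d}` — the `hμa` letter of ★ `…NearCellFlippedLetter` HEAD∕HEAD′ (there `n := jl + g + 1 − d`; at the flip digit
`jl = 2b + s0 + m* − 1` of `K₀` this is `n = 2b + m*` on the nose, `d = g + s0`). [cite: Serre1979, Ch. III §6 Prop. 12] [cite: Serre1979, Ch. V §3 Cor. 3] [cite: Jacobowitz1962, §4]
[cite: Rogawski1990, §4.9 Prop. 4.9.1 (b) p. 55] -/
theorem exists_fixed_unit_hlamE_ramM {σ : E →+* E} {ϖ : E} {d t : ℕ} (hD : IsRamifiedQuadraticDatum σ ϖ d t)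
    (jE : E →+* M) (hΘj : ∀ c, Θ (jE c) = jE (σ c)) (hρj : ∀ c, ρ (jE c) = jE c) (hα : ρ α ≠ α)
    {p q T Nα : E} (hΘα : Θ α = jE p + jE q * α) (hα2 : α * α = jE T * α - jE Nα) {g : ℕ} (hp : Valued.v p ≤ Valued.v ϖ ^ g)
    (hq : Valued.v q ≤ 1) (hNα : Valued.v Nα ≤ 1)
    {lam : M} {u μa μb : E} (hlam : lam = jE (u + μa) + jE μb * α) (hΘlam : Θ lam * lam = 1)
    (huu : u * σ u = 1) {Nu : ℕ} (hu1 : Valued.v (u - 1) ≤ Valued.v ϖ ^ Nu) (hA1 : Valued.v (u + μa) ≤ 1)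
    {b jl : ℕ} (hμa : Valued.v μa = Valued.v ϖ ^ (2 * b + d % 2)) (hμb : Valued.v μb ≤ Valued.v ϖ ^ jl)
    (hgjl : g ≤ jl) (hlo : 2 * b + d % 2 + d ≤ jl + g) (hhi : jl + g ≤ 2 * (2 * b + d % 2)) (hNu : jl + g ≤ Nu + 2 * b + d % 2) :
    ∃ f : E, σ f = f ∧ Valued.v f = 1 ∧
      Valued.v (μa + f * ((ϖ - σ ϖ) * ((ϖ * σ ϖ) ^ ((d - d % 2) / 2))⁻¹) * (ϖ * σ ϖ) ^ b) ≤ Valued.v ϖ ^ (jl + g + 1 - d) := by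
  have hvσ := hD.2.1
  have hϖ := hD.2.2.1
  have hϖ1 : Valued.v ϖ ≤ 1 := by rw [hϖ, ← exp_zero, exp_le_exp]; norm_num
  have hN : Valued.v ((u + μa) * σ (u + μa) - 1) ≤ Valued.v ϖ ^ (jl + g) :=
    v_norm_sub_one_le_of_theta σ hvσ hϖ1 jE hΘj hρj hα hΘα hα2 hlam hΘlam hA1 hμb hp hq hNα hgjl
  exact exists_fixed_unit_hlamE_of_norm hD huu hu1 hμa hN hlo hhi hNu

end MSide

end Summit.HodgeConjecture.HodgeConjecture.Cruxes.H413.F0P3cDyRamCleanELetterRamM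

end
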